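import Summits.HodgeConjecture.HodgeConjecture.Theorems.R90S9DefiniteAeRigidityPayLine      -- ★ p863000 (R90-IF-p06, (δ6c)) — imported for its ★ CONE ONLY (J10 `chiExpansion_gammaSph_of_allClasses_tensOfPair_levels`, `Ch14Bridge`, Gelfand level, LevelPins, `evpRep_of_ae_of_evp_piXiPrime`)
import Summits.HodgeConjecture.HodgeConjecture.Theorems.R90S9ArchSlotRecordA2              -- ★ (o4a) (R90-IF-p01 (g2), M2b-SLOT twin): `archSlot_binder_gammaSph_recordSCD_atUnitsOfRecord_partnerA2'` — the ROW-34-shaped SLOT READING; carries ★ p864911 + ★ M2b's cone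
import Summits.HodgeConjecture.HodgeConjecture.Theorems.R90S9EvpRigidityOfCore           -- ★ p863121 (R90-IF-p04 (g2), (e5′)): `InnerFormSec146.gradeRep_eq_of_evpRigidityCore`
import Summits.HodgeConjecture.HodgeConjecture.Theorems.R90S9Eq1462LevelAtPacket           -- ★ p863577 (R90-IF-p03 (g3), (LF-cut) (1)): `R90.S9.eq1462LevelTsum_at_of_thm1461_of_separation'` — (14.6.2) at ONE graded packet
import Summits.HodgeConjecture.HodgeConjecture.Theorems.R90S9ArchFinTraceSplitOfFrame       -- ★ p863065 (R90-IF-p04 (g2)): `R90.S9.archFinTraceSplit_of_frame` — `hAFS` from `hdef` + `h2`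
import HarnessLib

/-!
# R90-TF · S9 «InnerForm-13.3.6 (c)» — (o4b) THE M3-SLOT TWIN `archSlot_classOfSph_stableA2'`: THE ARCH-SLOT READING AT `π′ := [P]` UNDER THE HEAD'S OWN TELESCOPE
# (Rogawski 1990 proof of Thm. 14.6.4, p. 244 last display with §12.3 Prop. 12.3.3: a member of `Π(G′)` contributing to (14.6.3) at the A-packet `Π(ξ)` has archimedean component in `{πⁿ(ξ_ι), πˢ(ξ_ι)}` — compact type only)

Cell `hodgecm-mathlib`, crux H413 (`stmt-HodgeConjecture-24833`, `--supports … --as helper`); seat R90-IF-p02 (g3); dealer R90-IF-plan (g2) RULING R-J1 + DEAL (o4b) 2026-09-05T03:24:34Z ∕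
«GO (o4b)» 03:26:52Z: «SAME 79-binder telescope as ★ head `definiteAeRigidity_payLine_stableA2'` (byte-identical binder block so B feeds it under the head's σ), body = ★ M3 :318–:366 +
:378–:381 with ★ p864911's slot engine; it consumes p01's (o4a) M2b-slot twin».  R90-IF-p01 (g2)'s memo `ED5-rowJ77c-FINDINGS.p01.md` J1∕J5 (the S9 → S7 export «(S-G)∞» needs the slot
reading AT THE DATUM under the head's σ; trigger for `π′ := classOfSph P hsph` is ★).
THIS FILE = ★ M3 `Theorems/R90S9DefiniteAeRigidityStableRouteA2.lean` (p864612) with: (ⅰ) BINDER BLOCK byte-identical (all 79 residual binders, same order, same instance binders) except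
that the eight binders the slot reading does not consume carry the linter's `_` prefix — `_hcoverR _hframe _hDisj _htri _hApkt` (consumed only by the (S1) engine ∕ `sec146_of_levels'`,
★ M3 :376–:381) and `_hli _hvan144G _hvan144H` (consumed only by the (MN) binder `hmn`, ★ M3 :340–:352) — TYPES and POSITIONS unchanged, so FILE B applies it to the head's 88
explicit arguments with zero edits; (ⅱ) CONCLUSION = ★ p864911 `archSlot_gammaSphA2_guarded`'s slot reading at `π′ := classOfSph P hsph`, `P′ := Pξ`, `Ξ := Ξ_recordSCD`, letters
`(ξ′, h₁)`-indexed as in the head: for every one-dimensional `ξ′` lifting to `Pξ` with `m_v n_v ≠ 0` on `S₀`, `cpt ξ′ h₁ ∧ (tupleOf [P]).1 ∈ {a₀ ξ′ h₁, a₂ ξ′ h₁} ∧ ∀ v, (tupleOf [P]).2 v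
= πⁿ(ξ′_v) ∨ (p v ∧ (tupleOf [P]).2 v = πˢ(ξ′_v))`; (ⅲ) BODY = ★ M3 :318–:339 verbatim (`hμ hμK1 hν hleft`, J10 `hχ𝓕`, (14.6.1) `h61` on the stable route, Gelfand level `l₀`,
`hlevTA`, `hrigD`; the (MN) block struck), then ★ (o4a) `archSlot_binder_gammaSph_recordSCD_atUnitsOfRecord_partnerA2'` with ★ M3's :353–:366 argument list TOKEN FOR TOKEN, and the
TRIGGER discharged in-file from the head's own `ξ μA P hsph hAE Pξ hA hevpXi` exactly as ★ M3 :385 does: `hevp := gammaSph_evpRep_classOfSph ∘ evpRep_classOf ∘ evpRep_of_ae_of_evp_piXiPrime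
… hevpXi` ((AE) + «t(Π′(ξ)) = t(Π(ξ))» ⟹ «t([P]) = t(Π(ξ))»), `hm := mPrimeSph_ne_zero … hanis` (anisotropic `H`: every `K_c`-spherical class occurs).
CONSUMER (by name): FILE B ED. 5 row J77c `obtain ⟨hcpt, hι, hfin⟩ := archSlot_classOfSph_stableA2' ‹head σ› ξ′ h₁ hS hl` + p01's `mem_archPacketOfRecord_of_slot` under R-J3's pins
`ha₀pin ha₂pin := rfl` ⟹ S7's letter `SGInfTupleLetter` ∕ Index door `R90.S7.archMemberIota_of_sgInfTuple`.  The generic `(P′, ξ′, π′)` form is ★ (o4a) §4 itself — no twin here.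
THEOREMS ONLY (no `def`∕instance∕notation∕named fact∕`sorry`); imports ★ only, no `Lines` module; axioms TRIO.  HONEST LABEL: HC_CM is proved only modulo the 7 printed citations
(2 remaining named inputs: hLiu418 = stmt-HodgeConjecture-24832, h413 = stmt-HodgeConjecture-24833) until rung 0 closes; bookkeeping over ★ M3 ∕ ★ (o4a): the local identities
`hR₁ hR₂ hR₀G hR₀H`, (14.6.1)'s inputs `hG hH61 hvan hvanH h51k`, transfer existence `hex` and every other letter are HYPOTHESES; nothing unconditional is exported, no socket is paid
until an edition of FILE B consumes it; REL ≠ ★ ≠ BUILT.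
[cite: Rogawski1990, §12.3 Prop. 12.3.3 p. 178; §13.1 Prop. 13.1.4 p. 199; §14.4 Props. 14.4.1 (a)(c), 14.4.2 (c) p. 236; §14.5 Thm. 14.5.1 (b) p. 238; §14.6 Thm. 14.6.1 p. 241, p. 242 (14.6.2)–(14.6.3), Thm. 14.6.4 and its proof pp. 244–245; §13.6 Prop. 13.6.1 p. 208; §13.3 Thm. 13.3.5 p. 202; Prop. 13.8.1 p. 206]
[cite: FlathCorvallis1979, Thm. 3, Thm. 4] [cite: HarishChandra1953, Thms. 4–6] [cite: LabesseLanglands1979, Lemma 6.1] [cite: CartierCorvallis1979, §IV.1 Cor. 4.1]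
-/

set_option autoImplicit false
-- the mandated namespace repeats `HodgeConjecture.HodgeConjecture`, as in every `Theorems/*.lean` of this sub-problem
set_option linter.dupNamespace false
noncomputable section
open NumberField IsDedekindDomain MeasureTheory
open scoped Matrix ComplexOrder
open Literature.NumberTheory Literature.NumberTheory.Automorphic Literature.NumberTheory.Automorphic.UnitaryGroup
open Literature.NumberTheory.Automorphic.IdeleClassGroup
open Literature.NumberTheory.GaloisRepresentations
open Literature.NumberTheory.Rogawski1990
open Literature.RepresentationTheory.KonnoKonno2007 Literature.RepresentationTheory.KonnoKonno2007.RealDualPair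
open Literature.RepresentationTheory.KonnoKonno2007.RealDualPair.UForm
open Literature.NumberTheory.Automorphic.UnitaryGroup.CotangentForms (cmCompactFactor)
namespace Summit.HodgeConjecture.HodgeConjecture.R90.S9
open Summit.HodgeConjecture.HodgeConjecture.Cruxes.H413
open Summit.HodgeConjecture.HodgeConjecture.Cruxes.H413.F0P3GlobalPacket Summit.HodgeConjecture.HodgeConjecture.Cruxes.H413.F0P3LocalPacketKit
open Summit.HodgeConjecture.HodgeConjecture.Cruxes.H413.F0P3XiPacketFamilyOfRecordSCD (xiPacketFamilyOfRecordSCD hSCD_of_cmCharIdentityPackageTestSigned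
  hSCD_of_cmCharIdentityPackageTestSigned_fst)
open scoped Classical in
set_option synthInstance.maxHeartbeats 400000 in
set_option maxHeartbeats 8000000 in
/-- **(o4b) THE M3-SLOT TWIN `archSlot_classOfSph_stableA2'`** — under ★ M3 `definiteAeRigidity_payLine_stableA2'`'s own binder block (byte-identical; the eight slot-idle binders `_hcoverR _hframe _hDisj _htri _hApkt _hli _hvan144G _hvan144H` `_`-prefixed, types and positions unchanged), the ARCH-SLOT READING at the class `π′ := [P]` of the `K_c`-spherical `P` and the A-packet `Pξ`: for every one-dimensional `ξ′` lifting to `Pξ` with `m_v n_v ≠ 0` on `S₀`, the compact-type guard `cpt ξ′ h₁` holds, the archimedean component `(tupleOf [P]).1` is `a₀ ξ′ h₁ = πⁿ(ξ′_ι)` or `a₂ ξ′ h₁ = πˢ(ξ′_ι)` (§12.3 Prop. 12.3.3; p. 244 last display), and every finite component is `πⁿ(ξ′_v)`, or `πˢ(ξ′_v)` at a non-split `v`. Proof = ★ M3's prelude (J10 `hχ𝓕`, (14.6.1) `h61` on the stable route, Gelfand level, `hlevTA`, `hrigD`) into ★ (o4a) `archSlot_binder_gammaSph_recordSCD_atUnitsOfRecord_partnerA2'`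 (M3's `hcoeffMem` argument list token for token), the trigger `t([P]) = t(Π(ξ))` ∕ `m′([P]) ≠ 0` discharged as in ★ M3 from `hAE hevpXi hanis`. [cite: Rogawski1990, §12.3 Prop. 12.3.3 p. 178; §14.4 Props. 14.4.1 (a)(c), 14.4.2 (c) p. 236; §14.6 Thm. 14.6.1 p. 241, Thm. 14.6.4 and its proof pp. 244–245; §13.3 Thm. 13.3.5 p. 202] [cite: FlathCorvallis1979, Thm. 3, Thm. 4] [cite: HarishChandra1953, Thms. 4–6] -/
theorem archSlot_classOfSph_stableA2'
    (L : Type) [Field L] [NumberField L] [IsCMField L] (H : Matrix (Fin 3) (Fin 3) L)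
    (hH : (H.map (cmConjRingHom L))ᵀ = H) (hHd : IsUnit H.det)
    [∀ v : HeightOneSpectrum (𝓞 ↥(maximalRealSubfield L)), MeasurableSpace ((cmDatum L 3 H).Local v)]
    [∀ v : HeightOneSpectrum (𝓞 ↥(maximalRealSubfield L)), MeasurableSpace ((cmDatum L 2 (Matrix.of fun i j : Fin 2 => if i.val + j.val + 1 = 2 then (1 : L) else 0)).Local v × (cmDatum L 1 (Matrix.of fun i j : Fin 1 => if i.val + j.val + 1 = 1 then (1 : L) else 0)).Local v)]
    [∀ (v : HeightOneSpectrum (𝓞 ↥(maximalRealSubfield L))) (a : ((cmDatum L 2 (Matrix.of fun i j : Fin 2 => if i.val + j.val + 1 = 2 then (1 : L) else 0)).Local v × (cmDatum L 1 (Matrix.of fun i j : Fin 1 => if i.val + j.val + 1 = 1 then (1 : L) else 0)).Local v)),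
      MeasurableSpace (((cmDatum L 2 (Matrix.of fun i j : Fin 2 => if i.val + j.val + 1 = 2 then (1 : L) else 0)).Local v × (cmDatum L 1 (Matrix.of fun i j : Fin 1 => if i.val + j.val + 1 = 1 then (1 : L) else 0)).Local v) ⧸
        Subgroup.centralizer ({a} : Set ((cmDatum L 2 (Matrix.of fun i j : Fin 2 => if i.val + j.val + 1 = 2 then (1 : L) else 0)).Local v × (cmDatum L 1 (Matrix.of fun i j : Fin 1 => if i.val + j.val + 1 = 1 then (1 : L) else 0)).Local v)))]
    [∀ (v : HeightOneSpectrum (𝓞 ↥(maximalRealSubfield L))) (γ : (cmDatum L 3 H).Local v), MeasurableSpace ((cmDatum L 3 H).Local v ⧸ Subgroup.centralizer ({γ} : Set ((cmDatum L 3 H).Local v)))]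
    (Δ : ∀ v : HeightOneSpectrum (𝓞 ↥(maximalRealSubfield L)), LocalTransferFactor L H v)
    (mH : ∀ v : HeightOneSpectrum (𝓞 ↥(maximalRealSubfield L)), OrbitalMeasureFamily ((cmDatum L 2 (Matrix.of fun i j : Fin 2 => if i.val + j.val + 1 = 2 then (1 : L) else 0)).Local v × (cmDatum L 1 (Matrix.of fun i j : Fin 1 => if i.val + j.val + 1 = 1 then (1 : L) else 0)).Local v))
    (mG : ∀ v : HeightOneSpectrum (𝓞 ↥(maximalRealSubfield L)), OrbitalMeasureFamily ((cmDatum L 3 H).Local v))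
    (νG : ∀ v : HeightOneSpectrum (𝓞 ↥(maximalRealSubfield L)), Measure ((cmDatum L 3 H).Local v))
    (νH : ∀ v : HeightOneSpectrum (𝓞 ↥(maximalRealSubfield L)), Measure ((cmDatum L 2 (Matrix.of fun i j : Fin 2 => if i.val + j.val + 1 = 2 then (1 : L) else 0)).Local v × (cmDatum L 1 (Matrix.of fun i j : Fin 1 => if i.val + j.val + 1 = 1 then (1 : L) else 0)).Local v))
    [∀ v : HeightOneSpectrum (𝓞 ↥(maximalRealSubfield L)), BorelSpace ((cmDatum L 3 H).Local v)]
    [∀ v : HeightOneSpectrum (𝓞 ↥(maximalRealSubfield L)), BorelSpace ((cmDatum L 2 (Matrix.of fun i j : Fin 2 => if i.val + j.val + 1 = 2 then (1 : L) else 0)).Local v × (cmDatum L 1 (Matrix.of fun i j : Fin 1 => if i.val + j.val + 1 = 1 then (1 : L) else 0)).Local v)]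
    [∀ (v : HeightOneSpectrum (𝓞 ↥(maximalRealSubfield L))) (a : ((cmDatum L 2 (Matrix.of fun i j : Fin 2 => if i.val + j.val + 1 = 2 then (1 : L) else 0)).Local v × (cmDatum L 1 (Matrix.of fun i j : Fin 1 => if i.val + j.val + 1 = 1 then (1 : L) else 0)).Local v)),
      BorelSpace (((cmDatum L 2 (Matrix.of fun i j : Fin 2 => if i.val + j.val + 1 = 2 then (1 : L) else 0)).Local v × (cmDatum L 1 (Matrix.of fun i j : Fin 1 => if i.val + j.val + 1 = 1 then (1 : L) else 0)).Local v) ⧸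
        Subgroup.centralizer ({a} : Set ((cmDatum L 2 (Matrix.of fun i j : Fin 2 => if i.val + j.val + 1 = 2 then (1 : L) else 0)).Local v × (cmDatum L 1 (Matrix.of fun i j : Fin 1 => if i.val + j.val + 1 = 1 then (1 : L) else 0)).Local v)))]
    [∀ (v : HeightOneSpectrum (𝓞 ↥(maximalRealSubfield L))) (γ : (cmDatum L 3 H).Local v), BorelSpace ((cmDatum L 3 H).Local v ⧸ Subgroup.centralizer ({γ} : Set ((cmDatum L 3 H).Local v)))]
    [∀ v, (νG v).IsHaarMeasure] [∀ v, (νG v).IsMulRightInvariant] [∀ v, (νH v).IsHaarMeasure] [∀ v, (νH v).IsMulRightInvariant]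
    (hanis : ∀ x : Fin 3 → L, Literature.AlgebraicGeometry.ShimuraVarieties.hermForm (cmConjRingHom L) H x x = 0 → x = 0)
    (μω : HeckeCharacter L) (hμu : μω.IsUnitary)
    (hμω : ∀ x : Literature.NumberTheory.GaloisRepresentations.ideleGroup ↥(maximalRealSubfield L),
      μω (AdeleRing.ideleBaseChange (↥(maximalRealSubfield L)) L x) = quadraticHeckeCharCM L x)
    (hQS : CMCharIdentityPackageTestSigned L H hH hHd νH νG μω hμu Δ mH mG)
    (ι : L →+* ℂ) (T : GL (Fin 3) ℂ)
    (hT : (T : Matrix (Fin 3) (Fin 3) ℂ)ᴴ * H.map ι * (T : Matrix (Fin 3) (Fin 3) ℂ) = Literature.Geometry.ComplexHyperbolic.BallModel.J)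
    (ξ : OneDimAutRepH L)
    (μA : Measure (adelicGroupData (↥(maximalRealSubfield L)) L (IsCMField.complexConj L) 3 H).automorphicQuotient)
    [(adelicGroupData (↥(maximalRealSubfield L)) L (IsCMField.complexConj L) 3 H).IsAutomorphicMeasure μA]
    (P : DiscreteAutomorphicRep (adelicGroupData (↥(maximalRealSubfield L)) L (IsCMField.complexConj L) 3 H) μA)
    (hsph : InnerFormSec146.IsKcSpherical L ι H T hT μA P)
    (hAE : (∃ S : Finset (HeightOneSpectrum (𝓞 ↥(maximalRealSubfield L))), (∀ v : HeightOneSpectrum (𝓞 ↥(maximalRealSubfield L)), v ∉ S → ∀ (hns : ∀ w : PlacesOver L v, IsCMField.complexConj L • w.1 = w.1) (T : GL (Fin 3) (LocalRing L v)) (a : LocalRing L v) (ha : IsUnit a)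
            (h : formCongr (conjLocal L (IsCMField.complexConj L) v) T (H.map (algebraMap L (LocalRing L v))) = a • (Matrix.of fun i j : Fin 3 => if i.val + j.val + 1 = 3 then (1 : L) else 0).map (algebraMap L (LocalRing L v))),
          ∀ [MeasurableSpace (Gqs L v ⧸ Subgroup.center (Gqs L v))] [BorelSpace (Gqs L v ⧸ Subgroup.center (Gqs L v))] (μZ : Measure (Gqs L v ⧸ Subgroup.center (Gqs L v))) [μZ.IsHaarMeasure], ∀ (π2 πn : IrrClass (Gqs L v)),
            KeysCaseTwoLabels L v (μω.semilocalComponent L v) (torusLocalComponent L (IsCMField.complexConj L) v ξ.η) (torusLocalComponent L (IsCMField.complexConj L) v ξ.ψ) π2 πn → ¬ πn.IsSquareIntegrable μZ → ∀ c : IrrClass ((cmDatum L 3 H).Local v),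
              (IrrClass.comap (localPiEquiv L (IsCMField.complexConj L) 3 H v) c).IsConstituentOf (P.finRep.smoothPart.toRepresentation.comp (inclPlace (↥(maximalRealSubfield L)) L (IsCMField.complexConj L) 3 H v)) → c = IrrClass.comap (cmDatumLocalCongr L v T ha h).symm πn) ∧
        (∀ v : HeightOneSpectrum (𝓞 ↥(maximalRealSubfield L)), v ∉ S → ∀ (hs : ∃ w : PlacesOver L v, IsCMField.complexConj L • w.1 ≠ w.1), ∀ c : IrrClass ((cmDatum L 3 H).Local v), (IrrClass.comap (localPiEquiv L (IsCMField.complexConj L) 3 H v) c).IsConstituentOf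
                  (P.finRep.smoothPart.toRepresentation.comp (inclPlace (↥(maximalRealSubfield L)) L (IsCMField.complexConj L) 3 H v)) → c ∈ (cmSplitPacket L H hH hHd v (splitWitness v hs) (splitWitness_spec v hs) (ξ.splitν₀ μω (splitWitness v hs).1)
                (ξ.locψ (splitWitness v hs).1) (ξ.norm_splitν₀_apply hμu (splitWitness v hs).1) (ξ.continuous_splitν₀ μω (splitWitness v hs).1) (ξ.norm_locψ_apply (splitWitness v hs).1) (ξ.continuous_locψ (splitWitness v hs).1)).members)))
    [∀ v : HeightOneSpectrum (𝓞 ↥(maximalRealSubfield L)), MeasurableSpace (Gqs L v ⧸ Subgroup.center (Gqs L v))]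
    [∀ v : HeightOneSpectrum (𝓞 ↥(maximalRealSubfield L)), BorelSpace (Gqs L v ⧸ Subgroup.center (Gqs L v))]
    (μZ : ∀ v : HeightOneSpectrum (𝓞 ↥(maximalRealSubfield L)), Measure (Gqs L v ⧸ Subgroup.center (Gqs L v)))
    [∀ v : HeightOneSpectrum (𝓞 ↥(maximalRealSubfield L)), (μZ v).IsHaarMeasure]
    (keys : ∀ (ξ : OneDimAutRepH L) (v : HeightOneSpectrum (𝓞 ↥(maximalRealSubfield L))),
      (∀ w : PlacesOver L v, IsCMField.complexConj L • w.1 = w.1) →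
        {p : IrrClass (Gqs L v) × IrrClass (Gqs L v) //
          KeysCaseTwoLabels L v (μω.semilocalComponent L v) (torusLocalComponent L (IsCMField.complexConj L) v ξ.η)
            (torusLocalComponent L (IsCMField.complexConj L) v ξ.ψ) p.1 p.2 ∧
          p.1.IsSquareIntegrable (μZ v) ∧ ¬ p.2.IsSquareIntegrable (μZ v)})
    {H' : Matrix (Fin 3) (Fin 3) L} (𝔩 : ∀ v : HeightOneSpectrum (𝓞 ↥(maximalRealSubfield L)), LocalPacketKit L H' v)
    (μv : ∀ v : HeightOneSpectrum (𝓞 ↥(maximalRealSubfield L)), @Measure ((cmDatum L 3 H).Local v) (borel _))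
    [MeasurableSpace (adelicGroupData (↥(maximalRealSubfield L)) L (IsCMField.complexConj L) 3 H).Adelic] [BorelSpace (adelicGroupData (↥(maximalRealSubfield L)) L (IsCMField.complexConj L) 3 H).Adelic]
    (ν : Measure (adelicGroupData (↥(maximalRealSubfield L)) L (IsCMField.complexConj L) 3 H).Adelic) [IsFiniteMeasureOnCompacts ν]
    (νinf : @Measure (UnitaryGroup.arch (↥(maximalRealSubfield L)) L (IsCMField.complexConj L) 3 H) (borel _))
    -- `hAFS` DISCHARGED (★ `archFinTraceSplit_of_frame … hdef h2`, as in ★ p863803): its one letter `[L⁺:ℚ] ≥ 2`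
    (h2 : 2 ≤ Module.finrank ℚ ↥(maximalRealSubfield L))
    (hPH : F0P3LettersTraceFactorisation.IsProductHaar L H ν νinf μv)
    (X : InnerFormSec146.DatumInputs ((UnitaryGroup.arch (↥(maximalRealSubfield L)) L (IsCMField.complexConj L) 3 H → ℂ) ×
      (∀ v : HeightOneSpectrum (𝓞 ↥(maximalRealSubfield L)), (cmDatum L 3 H).Local v → ℂ))
      (CompactlySupportedContinuousMap (cmDatum L 3 (Matrix.of fun i j : Fin 3 => if i.val + j.val + 1 = 3 then (1 : L) else 0)).Adelic ℂ)
      (CompactlySupportedContinuousMap ((cmDatum L 2 (Matrix.of fun i j : Fin 2 => if i.val + j.val + 1 = 2 then (1 : L) else 0)).Adelic × (cmDatum L 1 (Matrix.of fun i j : Fin 1 => if i.val + j.val + 1 = 1 then (1 : L) else 0)).Adelic) ℂ) L ι H T hT μA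
      (xiPacketFamilyOfRecordSCD L H hH hHd μω hμu μZ keys (hSCD_of_cmCharIdentityPackageTestSigned L H hH hHd μω hμu Δ mH mG νG νH μZ hQS)) 𝔩)
    (htrX : ∀ (π' : (InnerFormSec146.RepPrimeSph L ι H T hT μA)) (p : ((UnitaryGroup.arch (↥(maximalRealSubfield L)) L (IsCMField.complexConj L) 3 H → ℂ) ×
      (∀ v : HeightOneSpectrum (𝓞 ↥(maximalRealSubfield L)), (cmDatum L 3 H).Local v → ℂ))),
      X.trPrime π' p = archTr₀ L ι H T hT νinf (InnerFormSec146.tupleOf L ι H T hT μA π').1 p.1 *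
        ∏ᶠ v, (letI : MeasurableSpace ((cmDatum L 3 H).Local v) := borel _;
          ((InnerFormSec146.tupleOf L ι H T hT μA π').2 v).smoothTrace (μv v) (p.2 v)))
    (hspecAll : ∀ (l : InnerFormSec146.Level L) (p : ((UnitaryGroup.arch (↥(maximalRealSubfield L)) L (IsCMField.complexConj L) 3 H → ℂ) ×
      (∀ v : HeightOneSpectrum (𝓞 ↥(maximalRealSubfield L)), (cmDatum L 3 H).Local v → ℂ))),
      InnerFormSec146.IsLevelTest L ι H T hT l p →
        Summable (fun c : InnerFormSec146.RepPrimeClass L H μA =>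
          (InnerFormSec146.mPrime L H μA c : ℂ) * F0P3SpectralSideOfRecord.trGp₀ (adelicGroupData (↥(maximalRealSubfield L)) L (IsCMField.complexConj L) 3 H) μA ν c (tensOfPair L H ι T hT p)) ∧
        X.traceL p = ∑' c : InnerFormSec146.RepPrimeClass L H μA,
          (InnerFormSec146.mPrime L H μA c : ℂ) * F0P3SpectralSideOfRecord.trGp₀ (adelicGroupData (↥(maximalRealSubfield L)) L (IsCMField.complexConj L) 3 H) μA ν c (tensOfPair L H ι T hT p))
    (Smooth : ((UnitaryGroup.arch (↥(maximalRealSubfield L)) L (IsCMField.complexConj L) 3 H → ℂ) ×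
      (∀ v : HeightOneSpectrum (𝓞 ↥(maximalRealSubfield L)), (cmDatum L 3 H).Local v → ℂ)) → Prop)
    (Transfer : ((UnitaryGroup.arch (↥(maximalRealSubfield L)) L (IsCMField.complexConj L) 3 H → ℂ) ×
      (∀ v : HeightOneSpectrum (𝓞 ↥(maximalRealSubfield L)), (cmDatum L 3 H).Local v → ℂ)) → (CompactlySupportedContinuousMap (cmDatum L 3 (Matrix.of fun i j : Fin 3 => if i.val + j.val + 1 = 3 then (1 : L) else 0)).Adelic ℂ) → Prop)
    (TransferH : ((UnitaryGroup.arch (↥(maximalRealSubfield L)) L (IsCMField.complexConj L) 3 H → ℂ) ×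
      (∀ v : HeightOneSpectrum (𝓞 ↥(maximalRealSubfield L)), (cmDatum L 3 H).Local v → ℂ)) → (CompactlySupportedContinuousMap ((cmDatum L 2 (Matrix.of fun i j : Fin 2 => if i.val + j.val + 1 = 2 then (1 : L) else 0)).Adelic × (cmDatum L 1 (Matrix.of fun i j : Fin 1 => if i.val + j.val + 1 = 1 then (1 : L) else 0)).Adelic) ℂ) → Prop)
    (SθG : (CompactlySupportedContinuousMap (cmDatum L 3 (Matrix.of fun i j : Fin 3 => if i.val + j.val + 1 = 3 then (1 : L) else 0)).Adelic ℂ) → ℂ)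
    (SθH : (CompactlySupportedContinuousMap ((cmDatum L 2 (Matrix.of fun i j : Fin 2 => if i.val + j.val + 1 = 2 then (1 : L) else 0)).Adelic × (cmDatum L 1 (Matrix.of fun i j : Fin 1 => if i.val + j.val + 1 = 1 then (1 : L) else 0)).Adelic) ℂ) → ℂ)
    (h51k : ∀ (f' : ((UnitaryGroup.arch (↥(maximalRealSubfield L)) L (IsCMField.complexConj L) 3 H → ℂ) ×
      (∀ v : HeightOneSpectrum (𝓞 ↥(maximalRealSubfield L)), (cmDatum L 3 H).Local v → ℂ)))
      (f : (CompactlySupportedContinuousMap (cmDatum L 3 (Matrix.of fun i j : Fin 3 => if i.val + j.val + 1 = 3 then (1 : L) else 0)).Adelic ℂ))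
      (fH : (CompactlySupportedContinuousMap ((cmDatum L 2 (Matrix.of fun i j : Fin 2 => if i.val + j.val + 1 = 2 then (1 : L) else 0)).Adelic × (cmDatum L 1 (Matrix.of fun i j : Fin 1 => if i.val + j.val + 1 = 1 then (1 : L) else 0)).Adelic) ℂ)),
      Smooth f' → Transfer f' f ∧ TransferH f' fH → X.traceL f' = SθG f + (1 / 2 : ℂ) * SθH fH)
    (PSVanish : (CompactlySupportedContinuousMap (cmDatum L 3 (Matrix.of fun i j : Fin 3 => if i.val + j.val + 1 = 3 then (1 : L) else 0)).Adelic ℂ) → Prop)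
    (PSVanishH : (CompactlySupportedContinuousMap ((cmDatum L 2 (Matrix.of fun i j : Fin 2 => if i.val + j.val + 1 = 2 then (1 : L) else 0)).Adelic × (cmDatum L 1 (Matrix.of fun i j : Fin 1 => if i.val + j.val + 1 = 1 then (1 : L) else 0)).Adelic) ℂ) → Prop)
    -- J8-R1: THE G-SIDE DISCRETE EXPANSION OF RECORD IS THE STABLE ONE (Prop. 13.6.1-reading «SΘ_G(f) = Σ n(Π) Tr Π(f)» on the vanishing class) — B: `sock_S9_stableSpecG_cm`
    (hG : X.G.StableDiscreteExpansionG X.tr SθG PSVanish)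
    (hH61 : X.G.StableDiscreteExpansionH X.trH SθH PSVanishH)
    (hvan : ∀ (f' : ((UnitaryGroup.arch (↥(maximalRealSubfield L)) L (IsCMField.complexConj L) 3 H → ℂ) ×
      (∀ v : HeightOneSpectrum (𝓞 ↥(maximalRealSubfield L)), (cmDatum L 3 H).Local v → ℂ)))
      (f : (CompactlySupportedContinuousMap (cmDatum L 3 (Matrix.of fun i j : Fin 3 => if i.val + j.val + 1 = 3 then (1 : L) else 0)).Adelic ℂ)), Smooth f' ∧ Transfer f' f → PSVanish f)
    (hvanH : ∀ (f' : ((UnitaryGroup.arch (↥(maximalRealSubfield L)) L (IsCMField.complexConj L) 3 H → ℂ) ×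
      (∀ v : HeightOneSpectrum (𝓞 ↥(maximalRealSubfield L)), (cmDatum L 3 H).Local v → ℂ)))
      (fH : (CompactlySupportedContinuousMap ((cmDatum L 2 (Matrix.of fun i j : Fin 2 => if i.val + j.val + 1 = 2 then (1 : L) else 0)).Adelic × (cmDatum L 1 (Matrix.of fun i j : Fin 1 => if i.val + j.val + 1 = 1 then (1 : L) else 0)).Adelic) ℂ)), TransferH f' fH → PSVanishH fH)
    (tw : ∀ l : InnerFormSec146.Level L, InnerFormSec146.HeckeOff L H l → (CompactlySupportedContinuousMap (cmDatum L 3 (Matrix.of fun i j : Fin 3 => if i.val + j.val + 1 = 3 then (1 : L) else 0)).Adelic ℂ) → (CompactlySupportedContinuousMap (cmDatum L 3 (Matrix.of fun i j : Fin 3 => if i.val + j.val + 1 = 3 then (1 : L) else 0)).Adelic ℂ))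
    (twH : ∀ l : InnerFormSec146.Level L, InnerFormSec146.HeckeOff L H l →
      (CompactlySupportedContinuousMap ((cmDatum L 2 (Matrix.of fun i j : Fin 2 => if i.val + j.val + 1 = 2 then (1 : L) else 0)).Adelic × (cmDatum L 1 (Matrix.of fun i j : Fin 1 => if i.val + j.val + 1 = 1 then (1 : L) else 0)).Adelic) ℂ) →
      (CompactlySupportedContinuousMap ((cmDatum L 2 (Matrix.of fun i j : Fin 2 => if i.val + j.val + 1 = 2 then (1 : L) else 0)).Adelic × (cmDatum L 1 (Matrix.of fun i j : Fin 1 => if i.val + j.val + 1 = 1 then (1 : L) else 0)).Adelic) ℂ))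
    -- F-LEV-1 (R90-IF-p04 (g3)): the Hecke-twist laws are asked only at levels containing a floor `l₁` (payer: `l₁ ⊇ S₀ ∪ {frameless} ∪ {ramified}`); at a level omitting a
    -- frameless place every packet is ungraded and the unguarded `hEP`∕`hEH` would force all packet traces of a transfer-twist to vanish (jointly unsatisfiable with (14.6.1) + positivity)
    (l₁ : InnerFormSec146.Level L)
    (hTw : ∀ (l : InnerFormSec146.Level L), l₁ ⊆ l → ∀ (h : InnerFormSec146.HeckeOff L H l) (f' : ((UnitaryGroup.arch (↥(maximalRealSubfield L)) L (IsCMField.complexConj L) 3 H → ℂ) ×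
      (∀ v : HeightOneSpectrum (𝓞 ↥(maximalRealSubfield L)), (cmDatum L 3 H).Local v → ℂ)))
      (f : (CompactlySupportedContinuousMap (cmDatum L 3 (Matrix.of fun i j : Fin 3 => if i.val + j.val + 1 = 3 then (1 : L) else 0)).Adelic ℂ)),
      InnerFormSec146.IsLevelTest L ι H T hT l f' → (Smooth f' ∧ Transfer f' f) →
        (Smooth (InnerFormSec146.twistTest L H μv l h f') ∧ Transfer (InnerFormSec146.twistTest L H μv l h f') (tw l h f)))
    (hTHw : ∀ (l : InnerFormSec146.Level L), l₁ ⊆ l → ∀ (h : InnerFormSec146.HeckeOff L H l) (f' : ((UnitaryGroup.arch (↥(maximalRealSubfield L)) L (IsCMField.complexConj L) 3 H → ℂ) ×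
      (∀ v : HeightOneSpectrum (𝓞 ↥(maximalRealSubfield L)), (cmDatum L 3 H).Local v → ℂ)))
      (fH : (CompactlySupportedContinuousMap ((cmDatum L 2 (Matrix.of fun i j : Fin 2 => if i.val + j.val + 1 = 2 then (1 : L) else 0)).Adelic × (cmDatum L 1 (Matrix.of fun i j : Fin 1 => if i.val + j.val + 1 = 1 then (1 : L) else 0)).Adelic) ℂ)),
      InnerFormSec146.IsLevelTest L ι H T hT l f' → TransferH f' fH → TransferH (InnerFormSec146.twistTest L H μv l h f') (twH l h fH))
    (hEP : ∀ (l : InnerFormSec146.Level L), l₁ ⊆ l → ∀ (h : InnerFormSec146.HeckeOff L H l) (f' : ((UnitaryGroup.arch (↥(maximalRealSubfield L)) L (IsCMField.complexConj L) 3 H → ℂ) ×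
      (∀ v : HeightOneSpectrum (𝓞 ↥(maximalRealSubfield L)), (cmDatum L 3 H).Local v → ℂ)))
      (f : (CompactlySupportedContinuousMap (cmDatum L 3 (Matrix.of fun i j : Fin 3 => if i.val + j.val + 1 = 3 then (1 : L) else 0)).Adelic ℂ)),
      InnerFormSec146.IsLevelTest L ι H T hT l f' → (Smooth f' ∧ Transfer f' f) → ∀ P : X.G.Packet,
        X.G.packetTrace X.tr P (tw l h f) =
          ((InnerFormSec146.gradePacket _ _ _ L ι H T hT μA μv (xiPacketFamilyOfRecordSCD L H hH hHd μω hμu μZ keys (hSCD_of_cmCharIdentityPackageTestSigned L H hH hHd μω hμu Δ mH mG νG νH μZ hQS)) 𝔩 X l P).elim 0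
            fun e => InnerFormSec146.evOff L H μv l e h) * X.G.packetTrace X.tr P f)
    (hEH : ∀ (l : InnerFormSec146.Level L), l₁ ⊆ l → ∀ (h : InnerFormSec146.HeckeOff L H l) (f' : ((UnitaryGroup.arch (↥(maximalRealSubfield L)) L (IsCMField.complexConj L) 3 H → ℂ) ×
      (∀ v : HeightOneSpectrum (𝓞 ↥(maximalRealSubfield L)), (cmDatum L 3 H).Local v → ℂ)))
      (fH : (CompactlySupportedContinuousMap ((cmDatum L 2 (Matrix.of fun i j : Fin 2 => if i.val + j.val + 1 = 2 then (1 : L) else 0)).Adelic × (cmDatum L 1 (Matrix.of fun i j : Fin 1 => if i.val + j.val + 1 = 1 then (1 : L) else 0)).Adelic) ℂ)),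
      InnerFormSec146.IsLevelTest L ι H T hT l f' → TransferH f' fH → ∀ ρ : X.G.PacketH,
        X.trH ρ (twH l h fH) =
          ((InnerFormSec146.gradePacketH _ _ _ L ι H T hT μA μv (xiPacketFamilyOfRecordSCD L H hH hHd μω hμu μZ keys (hSCD_of_cmCharIdentityPackageTestSigned L H hH hHd μω hμu Δ mH mG νG νH μZ hQS)) 𝔩 X l ρ).elim 0
            fun e => InnerFormSec146.evOff L H μv l e h) * X.trH ρ fH)
    (hsepL : ∀ l : InnerFormSec146.Level L,
      IsCountablyLinIndepOn (InnerFormSec146.EvpSupport L H μv l) (fun _ : InnerFormSec146.HeckeOff L H l => True) (InnerFormSec146.evOff L H μv l))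
    (_hcoverR : ∀ π' : (InnerFormSec146.RepPrimeSph L ι H T hT μA), InnerFormSec146.mPrimeSph L ι H T hT μA π' ≠ 0 → ∀ l₀ : InnerFormSec146.Level L,
      ∃ l : InnerFormSec146.Level L, l₀ ⊆ l ∧ ∃ (e : InnerFormSec146.Evp L H) (f₀ : ((UnitaryGroup.arch (↥(maximalRealSubfield L)) L (IsCMField.complexConj L) 3 H → ℂ) ×
      (∀ v : HeightOneSpectrum (𝓞 ↥(maximalRealSubfield L)), (cmDatum L 3 H).Local v → ℂ)))
        (f : (CompactlySupportedContinuousMap (cmDatum L 3 (Matrix.of fun i j : Fin 3 => if i.val + j.val + 1 = 3 then (1 : L) else 0)).Adelic ℂ))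
        (fH : (CompactlySupportedContinuousMap ((cmDatum L 2 (Matrix.of fun i j : Fin 2 => if i.val + j.val + 1 = 2 then (1 : L) else 0)).Adelic × (cmDatum L 1 (Matrix.of fun i j : Fin 1 => if i.val + j.val + 1 = 1 then (1 : L) else 0)).Adelic) ℂ)),
        InnerFormSec146.gradeRep L ι H T hT μA μv l π' = some e ∧ InnerFormSec146.IsLevelTest L ι H T hT l f₀ ∧ (Smooth f₀ ∧ Transfer f₀ f) ∧ TransferH f₀ fH ∧
          (∀ π : (InnerFormSec146.RepPrimeSph L ι H T hT μA), 0 ≤ (InnerFormSec146.mPrimeSph L ι H T hT μA π : ℂ) * X.trPrime π f₀) ∧ (InnerFormSec146.mPrimeSph L ι H T hT μA π' : ℂ) * X.trPrime π' f₀ ≠ 0)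
    (_hframe : ∀ᶠ v : HeightOneSpectrum (𝓞 ↥(maximalRealSubfield L)) in Filter.cofinite,
      ∃ (T₁ : GL (Fin 3) (LocalRing L v)) (a : LocalRing L v) (ha : IsUnit a)
        (h : formCongr (conjLocal L (IsCMField.complexConj L) v) T₁ (H.map (algebraMap L (LocalRing L v))) = a • H'.map (algebraMap L (LocalRing L v))),
        ∀ g : (cmDatum L 3 H).Local v, (cmDatumLocalCongr L v T₁ ha h).symm g ∈ cmLocalIntegralLevel L 3 H' v ↔ g ∈ cmLocalIntegralLevel L 3 H v)
    (htP : ∀ (l : InnerFormSec146.Level L) (P Q : X.G.Packet) (e : InnerFormSec146.Evp L H),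
      InnerFormSec146.gradePacket _ _ _ L ι H T hT μA μv (xiPacketFamilyOfRecordSCD L H hH hHd μω hμu μZ keys (hSCD_of_cmCharIdentityPackageTestSigned L H hH hHd μω hμu Δ mH mG νG νH μZ hQS)) 𝔩 X l P = some e →
      InnerFormSec146.gradePacket _ _ _ L ι H T hT μA μv (xiPacketFamilyOfRecordSCD L H hH hHd μω hμu μZ keys (hSCD_of_cmCharIdentityPackageTestSigned L H hH hHd μω hμu Δ mH mG νG νH μZ hQS)) 𝔩 X l Q = some e → P = Q)
    (_hDisj : ∀ v : HeightOneSpectrum (𝓞 ↥(maximalRealSubfield L)), InnerFormSec146.APacketsOfRecordDisjointAt L H (xiPacketFamilyOfRecordSCD L H hH hHd μω hμu μZ keys (hSCD_of_cmCharIdentityPackageTestSigned L H hH hHd μω hμu Δ mH mG νG νH μZ hQS)) v)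
    (_htri : X.G.PacketTrichotomy)
    (_hApkt : ∀ P : X.G.Packet, X.G.IsAPacket P → ∃ ξ : X.G.PacketH, X.IsOneDimH ξ ∧ X.G.liftsTo ξ P)
    (hliftE : ∀ (l : InnerFormSec146.Level L) (ρ : X.G.PacketH) (P : X.G.Packet) (e : InnerFormSec146.Evp L H),
      InnerFormSec146.gradePacket _ _ _ L ι H T hT μA μv (xiPacketFamilyOfRecordSCD L H hH hHd μω hμu μZ keys (hSCD_of_cmCharIdentityPackageTestSigned L H hH hHd μω hμu Δ mH mG νG νH μZ hQS)) 𝔩 X l P = some e →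
        (X.G.liftsTo ρ P ↔ InnerFormSec146.gradePacketH _ _ _ L ι H T hT μA μv (xiPacketFamilyOfRecordSCD L H hH hHd μω hμu μZ keys (hSCD_of_cmCharIdentityPackageTestSigned L H hH hHd μω hμu Δ mH mG νG νH μZ hQS)) 𝔩 X l ρ = some e))
    -- (LF-cut) ED. 5: NO `hlifts : ∀ P, (X.G.lifts P).Finite` binder — `|Π̂(P)| < ∞` is read only at A-packets, where `lifts P = {ξ}` (`hlifts1`)
    (hnH : ∀ ξ : X.G.PacketH, X.IsOneDimH ξ → X.G.nH ξ = 1)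
    (_hli : IsCountablyLinIndepOn (Set.univ : Set (InnerFormSec146.RepPrimeSph L ι H T hT μA))
      (fun φf : ((UnitaryGroup.arch (↥(maximalRealSubfield L)) L (IsCMField.complexConj L) 3 H → ℂ) ×
      (∀ v : HeightOneSpectrum (𝓞 ↥(maximalRealSubfield L)), (cmDatum L 3 H).Local v → ℂ)) =>
        (ArchTestKc L ι H T hT φf.1 ∧ (∀ v, IsLocallyConstant (φf.2 v) ∧ HasCompactSupport (φf.2 v)) ∧
        {v | φf.2 v ≠ (cmLocalIntegralLevel L 3 H v : Set ((cmDatum L 3 H).Local v)).indicator fun _ => (1 : ℂ)}.Finite))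
      (fun π' p => X.trPrime π' p))
    (hex : ∀ φf : ((UnitaryGroup.arch (↥(maximalRealSubfield L)) L (IsCMField.complexConj L) 3 H → ℂ) ×
      (∀ v : HeightOneSpectrum (𝓞 ↥(maximalRealSubfield L)), (cmDatum L 3 H).Local v → ℂ)),
      (ArchTestKc L ι H T hT φf.1 ∧ (∀ v, IsLocallyConstant (φf.2 v) ∧ HasCompactSupport (φf.2 v)) ∧
        {v | φf.2 v ≠ (cmLocalIntegralLevel L 3 H v : Set ((cmDatum L 3 H).Local v)).indicator fun _ => (1 : ℂ)}.Finite) →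
      ∃ (f : (CompactlySupportedContinuousMap (cmDatum L 3 (Matrix.of fun i j : Fin 3 => if i.val + j.val + 1 = 3 then (1 : L) else 0)).Adelic ℂ))
        (fH : (CompactlySupportedContinuousMap ((cmDatum L 2 (Matrix.of fun i j : Fin 2 => if i.val + j.val + 1 = 2 then (1 : L) else 0)).Adelic × (cmDatum L 1 (Matrix.of fun i j : Fin 1 => if i.val + j.val + 1 = 1 then (1 : L) else 0)).Adelic) ℂ)),
        (Smooth φf ∧ Transfer φf f) ∧ TransferH φf fH)
    (hcover𝓣 : ∀ f' : ((UnitaryGroup.arch (↥(maximalRealSubfield L)) L (IsCMField.complexConj L) 3 H → ℂ) ×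
      (∀ v : HeightOneSpectrum (𝓞 ↥(maximalRealSubfield L)), (cmDatum L 3 H).Local v → ℂ)),
      (ArchTestKc L ι H T hT f'.1 ∧ (∀ v, IsLocallyConstant (f'.2 v) ∧ HasCompactSupport (f'.2 v)) ∧
        {v | f'.2 v ≠ (cmLocalIntegralLevel L 3 H v : Set ((cmDatum L 3 H).Local v)).indicator fun _ => (1 : ℂ)}.Finite) → ∀ P : X.G.Packet,
      (∃ π' : (InnerFormSec146.RepPrimeSph L ι H T hT μA), InnerFormSec146.mPrimeSph L ι H T hT μA π' ≠ 0 ∧ InnerFormSec146.evpRep L H μA 𝔩 π'.1 (X.finOfG P)) →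
        ∀ l₀ : InnerFormSec146.Level L, ∃ l : InnerFormSec146.Level L, l₀ ⊆ l ∧ ∃ e : InnerFormSec146.Evp L H,
          InnerFormSec146.IsLevelTest L ι H T hT l f' ∧ InnerFormSec146.gradePacket _ _ _ L ι H T hT μA μv (xiPacketFamilyOfRecordSCD L H hH hHd μω hμu μZ keys (hSCD_of_cmCharIdentityPackageTestSigned L H hH hHd μω hμu Δ mH mG νG νH μZ hQS)) 𝔩 X l P = some e)
    -- S5 — THE E.V.P. RIGIDITY CORE per level (Thm. 13.3.5; p. 242 l. 15), p04 (g2)'s ★ p863121 socket shape `sock_S9_evpRigidityCore_cm` BYTEWISE at generic `X`: germ ⟹ transport off the level for spherical components; `hrig` is DERIVED in-file at the Gelfand levels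
    (hcore : ∀ (l : InnerFormSec146.Level L) (π' : InnerFormSec146.RepPrimeSph L ι H T hT μA) (P : X.G.Packet) (e : InnerFormSec146.Evp L H),
      InnerFormSec146.gradePacket _ _ _ L ι H T hT μA μv (xiPacketFamilyOfRecordSCD L H hH hHd μω hμu μZ keys (hSCD_of_cmCharIdentityPackageTestSigned L H hH hHd μω hμu Δ mH mG νG νH μZ hQS)) 𝔩 X l P = some e →
      (InnerFormSec146.gammaSph _ _ _ L ι H T hT μA (xiPacketFamilyOfRecordSCD L H hH hHd μω hμu μZ keys (hSCD_of_cmCharIdentityPackageTestSigned L H hH hHd μω hμu Δ mH mG νG νH μZ hQS)) 𝔩 X).evpRep π' P →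
        (∀ v, v ∉ l → ((InnerFormSec146.tupleOf L ι H T hT μA π').2 v).IsSpherical (cmLocalIntegralLevel L 3 H v)) →
          ∀ v, v ∉ l → InnerFormSec146.TransportsToSphAt L H 𝔩 v ((InnerFormSec146.tupleOf L ι H T hT μA π').2 v) ((X.finOfG P).loc v))
    (hlifts1 : ∀ (P : X.G.Packet) (ξ : X.G.PacketH), X.G.IsAPacket P → X.IsOneDimH ξ → X.G.liftsTo ξ P → X.G.lifts P = {ξ})
    (hn : ∀ (P : X.G.Packet) (ξ : X.G.PacketH), X.G.IsAPacket P → X.IsOneDimH ξ → X.G.liftsTo ξ P → X.G.n P = 1 / 2)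
    (_hvan144G : ∀ (P : X.G.Packet) (ξ : X.G.PacketH) (v : InnerFormSec146.Place L), v ∈ InnerFormSec146.S0 L H → X.IsOneDimH ξ → X.G.liftsTo ξ P → ¬ X.MnNeZero ξ v →
      ∀ (f' : ((UnitaryGroup.arch (↥(maximalRealSubfield L)) L (IsCMField.complexConj L) 3 H → ℂ) ×
      (∀ v : HeightOneSpectrum (𝓞 ↥(maximalRealSubfield L)), (cmDatum L 3 H).Local v → ℂ))) (f : (CompactlySupportedContinuousMap (cmDatum L 3 (Matrix.of fun i j : Fin 3 => if i.val + j.val + 1 = 3 then (1 : L) else 0)).Adelic ℂ)),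
        (ArchTestKc L ι H T hT f'.1 ∧ (∀ v, IsLocallyConstant (f'.2 v) ∧ HasCompactSupport (f'.2 v)) ∧
        {v | f'.2 v ≠ (cmLocalIntegralLevel L 3 H v : Set ((cmDatum L 3 H).Local v)).indicator fun _ => (1 : ℂ)}.Finite) →
        (Smooth f' ∧ Transfer f' f) → X.G.packetTrace X.tr P f = 0)
    (_hvan144H : ∀ (ξ : X.G.PacketH) (v : InnerFormSec146.Place L), v ∈ InnerFormSec146.S0 L H → X.IsOneDimH ξ → ¬ X.MnNeZero ξ v →
      ∀ (f' : ((UnitaryGroup.arch (↥(maximalRealSubfield L)) L (IsCMField.complexConj L) 3 H → ℂ) ×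
      (∀ v : HeightOneSpectrum (𝓞 ↥(maximalRealSubfield L)), (cmDatum L 3 H).Local v → ℂ))) (fH : (CompactlySupportedContinuousMap ((cmDatum L 2 (Matrix.of fun i j : Fin 2 => if i.val + j.val + 1 = 2 then (1 : L) else 0)).Adelic × (cmDatum L 1 (Matrix.of fun i j : Fin 1 => if i.val + j.val + 1 = 1 then (1 : L) else 0)).Adelic) ℂ)),
        (ArchTestKc L ι H T hT f'.1 ∧ (∀ v, IsLocallyConstant (f'.2 v) ∧ HasCompactSupport (f'.2 v)) ∧
        {v | f'.2 v ≠ (cmLocalIntegralLevel L 3 H v : Set ((cmDatum L 3 H).Local v)).indicator fun _ => (1 : ℂ)}.Finite) →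
        TransferH f' fH → X.trH ξ fH = 0)
    (hdef : ∀ τ' : L →+* ℂ, InfinitePlace.mk τ' ≠ InfinitePlace.mk ι → (H.map τ').PosDef)
    (hquad : ∀ v : HeightOneSpectrum (𝓞 ↥(maximalRealSubfield L)), (∀ w : PlacesOver L v, IsCMField.complexConj L • w.1 = w.1) →
      IsQuadraticCharExtension (conjLocal L (IsCMField.complexConj L) v) (μω.semilocalComponent L v))
    (hF1b : ∀ P₀ Q₀ : DiscreteAutomorphicRep (adelicGroupData (↥(maximalRealSubfield L)) L (IsCMField.complexConj L) 3 H) μA,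
      InnerFormSec146.IsKcSpherical L ι H T hT μA P₀ → InnerFormSec146.IsKcSpherical L ι H T hT μA Q₀ →
      P₀.UnitaryEquivOfComponents Q₀ (uFormGroup (Fin 2) (Fin 1)) (cmArchSectionUForm L ι H T hT) (cmCompactFactor L ι H T hT))
    (hARCH : ArchComponentOfDiscrete L ι H T hT μA)
    (p : ∀ ξ : X.G.PacketH, X.IsOneDimH ξ → HeightOneSpectrum (𝓞 ↥(maximalRealSubfield L)) → Prop)
    (hp : ∀ (ξ : X.G.PacketH) (h₁ : X.IsOneDimH ξ) (v : HeightOneSpectrum (𝓞 ↥(maximalRealSubfield L))), p ξ h₁ v →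
      ∀ w : PlacesOver L v, IsCMField.complexConj L • w.1 = w.1)
    -- «A2»: the TWO archimedean members `πⁿ(ξ_ι)`, `πˢ(ξ_ι)` at the non-compact place `ι` [§12.3 Prop. 12.3.3] (laws = ★ `globalCharactersLinIndep`'s support conjunct verbatim), distinct
    (a₀ a₂ : ∀ ξ : X.G.PacketH, X.IsOneDimH ξ → GKIrrClass (uFormGroup (Fin 2) (Fin 1)))
    (ha₀ : ∀ (ξ : X.G.PacketH) (h₁ : X.IsOneDimH ξ), ∃ r : GKIrrep (uFormGroup (Fin 2) (Fin 1)), GKIrrClass.mk r = a₀ ξ h₁ ∧ IsAdmissibleGK r.ρK ∧ r.IsInfUnitaryAlongP)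
    (ha₂ : ∀ (ξ : X.G.PacketH) (h₁ : X.IsOneDimH ξ), ∃ r : GKIrrep (uFormGroup (Fin 2) (Fin 1)), GKIrrClass.mk r = a₂ ξ h₁ ∧ IsAdmissibleGK r.ρK ∧ r.IsInfUnitaryAlongP)
    (hane : ∀ (ξ : X.G.PacketH) (h₁ : X.IsOneDimH ξ), a₂ ξ h₁ ≠ a₀ ξ h₁)
    (cpt : ∀ ξ : X.G.PacketH, X.IsOneDimH ξ → Prop) -- «A2» the COMPACT-TYPE GUARD at `ξ` (B: `cptXi₀ ι μω …`): the identities hold on it, the traces VANISH off it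
    (hR₁ : ∀ (P : X.G.Packet) (ξ : X.G.PacketH) (h₁ : X.IsOneDimH ξ), X.G.IsAPacket P → X.G.liftsTo ξ P → cpt ξ h₁ →
      ∀ φf (f : (CompactlySupportedContinuousMap (cmDatum L 3 (Matrix.of fun i j : Fin 3 => if i.val + j.val + 1 = 3 then (1 : L) else 0)).Adelic ℂ)), (ArchTestKc L ι H T hT φf.1 ∧ (∀ v, IsLocallyConstant (φf.2 v) ∧ HasCompactSupport (φf.2 v)) ∧ {v | φf.2 v ≠ (cmLocalIntegralLevel L 3 H v : Set ((cmDatum L 3 H).Local v)).indicator fun _ => (1 : ℂ)}.Finite) →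
      (Smooth φf ∧ Transfer φf f) →
      X.G.packetTrace X.tr P f =
        (-1) ^ (InnerFormSec146.gammaSph _ (CompactlySupportedContinuousMap (cmDatum L 3 (Matrix.of fun i j : Fin 3 => if i.val + j.val + 1 = 3 then (1 : L) else 0)).Adelic ℂ)
          (CompactlySupportedContinuousMap ((cmDatum L 2 (Matrix.of fun i j : Fin 2 => if i.val + j.val + 1 = 2 then (1 : L) else 0)).Adelic × (cmDatum L 1 (Matrix.of fun i j : Fin 1 => if i.val + j.val + 1 = 1 then (1 : L) else 0)).Adelic) ℂ) L ι H T hT μA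
          (xiPacketFamilyOfRecordSCD L H hH hHd μω hμu μZ keys (hSCD_of_cmCharIdentityPackageTestSigned L H hH hHd μω hμu Δ mH mG νG νH μZ hQS)) 𝔩 X).N *
          ((archTr₀ L ι H T hT νinf (a₀ ξ h₁) φf.1 - archTr₀ L ι H T hT νinf (a₂ ξ h₁) φf.1) *
            ∏ v ∈ (xiTruncOfRecordSCD L H hH hHd μω hμu μZ keys (hSCD_of_cmCharIdentityPackageTestSigned L H hH hHd μω hμu Δ mH mG νG νH μZ hQS) μv (X.oneDimOf ξ h₁) φf.2) with ¬ p ξ h₁ v, (letI : MeasurableSpace ((cmDatum L 3 H).Local v) := borel _;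
              (((xiPacketFamilyOfRecordSCD L H hH hHd μω hμu μZ keys (hSCD_of_cmCharIdentityPackageTestSigned L H hH hHd μω hμu Δ mH mG νG νH μZ hQS)) (X.oneDimOf ξ h₁) v).πn).smoothTrace (μv v) (φf.2 v))) *
          ∏ i ∈ (xiTruncOfRecordSCD L H hH hHd μω hμu μZ keys (hSCD_of_cmCharIdentityPackageTestSigned L H hH hHd μω hμu Δ mH mG νG νH μZ hQS) μv (X.oneDimOf ξ h₁) φf.2).subtype (p ξ h₁), (letI : MeasurableSpace ((cmDatum L 3 H).Local i) := borel _;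
            ((((xiPacketFamilyOfRecordSCD L H hH hHd μω hμu μZ keys (hSCD_of_cmCharIdentityPackageTestSigned L H hH hHd μω hμu Δ mH mG νG νH μZ hQS)) (X.oneDimOf ξ h₁) (i : _)).πn).smoothTrace (μv i) (φf.2 i) -
              (((xiPacketFamilyOfRecordSCD L H hH hHd μω hμu μZ keys (hSCD_of_cmCharIdentityPackageTestSigned L H hH hHd μω hμu Δ mH mG νG νH μZ hQS)) (X.oneDimOf ξ h₁) (i : _)).πs.getD ((xiPacketFamilyOfRecordSCD L H hH hHd μω hμu μZ keys (hSCD_of_cmCharIdentityPackageTestSigned L H hH hHd μω hμu Δ mH mG νG νH μZ hQS)) (X.oneDimOf ξ h₁) (i : _)).πn).smoothTrace (μv i) (φf.2 i))))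
    (hR₂ : ∀ (ξ : X.G.PacketH) (h₁ : X.IsOneDimH ξ), cpt ξ h₁ → ∀ φf (fH : (CompactlySupportedContinuousMap ((cmDatum L 2 (Matrix.of fun i j : Fin 2 => if i.val + j.val + 1 = 2 then (1 : L) else 0)).Adelic × (cmDatum L 1 (Matrix.of fun i j : Fin 1 => if i.val + j.val + 1 = 1 then (1 : L) else 0)).Adelic) ℂ)), (ArchTestKc L ι H T hT φf.1 ∧ (∀ v, IsLocallyConstant (φf.2 v) ∧ HasCompactSupport (φf.2 v)) ∧ {v | φf.2 v ≠ (cmLocalIntegralLevel L 3 H v : Set ((cmDatum L 3 H).Local v)).indicator fun _ => (1 : ℂ)}.Finite) →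
      TransferH φf fH →
      X.trH ξ fH =
        (-1) ^ (InnerFormSec146.gammaSph _ (CompactlySupportedContinuousMap (cmDatum L 3 (Matrix.of fun i j : Fin 3 => if i.val + j.val + 1 = 3 then (1 : L) else 0)).Adelic ℂ)
          (CompactlySupportedContinuousMap ((cmDatum L 2 (Matrix.of fun i j : Fin 2 => if i.val + j.val + 1 = 2 then (1 : L) else 0)).Adelic × (cmDatum L 1 (Matrix.of fun i j : Fin 1 => if i.val + j.val + 1 = 1 then (1 : L) else 0)).Adelic) ℂ) L ι H T hT μA
          (xiPacketFamilyOfRecordSCD L H hH hHd μω hμu μZ keys (hSCD_of_cmCharIdentityPackageTestSigned L H hH hHd μω hμu Δ mH mG νG νH μZ hQS)) 𝔩 X).N * (InnerFormSec146.gammaSph _ (CompactlySupportedContinuousMap (cmDatum L 3 (Matrix.of fun i j : Fin 3 => if i.val + j.val + 1 = 3 then (1 : L) else 0)).Adelic ℂ)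
          (CompactlySupportedContinuousMap ((cmDatum L 2 (Matrix.of fun i j : Fin 2 => if i.val + j.val + 1 = 2 then (1 : L) else 0)).Adelic × (cmDatum L 1 (Matrix.of fun i j : Fin 1 => if i.val + j.val + 1 = 1 then (1 : L) else 0)).Adelic) ℂ) L ι H T hT μA
          (xiPacketFamilyOfRecordSCD L H hH hHd μω hμu μZ keys (hSCD_of_cmCharIdentityPackageTestSigned L H hH hHd μω hμu Δ mH mG νG νH μZ hQS)) 𝔩 X).c *
          ((archTr₀ L ι H T hT νinf (a₀ ξ h₁) φf.1 + archTr₀ L ι H T hT νinf (a₂ ξ h₁) φf.1) *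
            ∏ v ∈ (xiTruncOfRecordSCD L H hH hHd μω hμu μZ keys (hSCD_of_cmCharIdentityPackageTestSigned L H hH hHd μω hμu Δ mH mG νG νH μZ hQS) μv (X.oneDimOf ξ h₁) φf.2) with ¬ p ξ h₁ v, (letI : MeasurableSpace ((cmDatum L 3 H).Local v) := borel _;
              (((xiPacketFamilyOfRecordSCD L H hH hHd μω hμu μZ keys (hSCD_of_cmCharIdentityPackageTestSigned L H hH hHd μω hμu Δ mH mG νG νH μZ hQS)) (X.oneDimOf ξ h₁) v).πn).smoothTrace (μv v) (φf.2 v))) *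
          ∏ i ∈ (xiTruncOfRecordSCD L H hH hHd μω hμu μZ keys (hSCD_of_cmCharIdentityPackageTestSigned L H hH hHd μω hμu Δ mH mG νG νH μZ hQS) μv (X.oneDimOf ξ h₁) φf.2).subtype (p ξ h₁), (letI : MeasurableSpace ((cmDatum L 3 H).Local i) := borel _;
            ((((xiPacketFamilyOfRecordSCD L H hH hHd μω hμu μZ keys (hSCD_of_cmCharIdentityPackageTestSigned L H hH hHd μω hμu Δ mH mG νG νH μZ hQS)) (X.oneDimOf ξ h₁) (i : _)).πn).smoothTrace (μv i) (φf.2 i) +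
              (((xiPacketFamilyOfRecordSCD L H hH hHd μω hμu μZ keys (hSCD_of_cmCharIdentityPackageTestSigned L H hH hHd μω hμu Δ mH mG νG νH μZ hQS)) (X.oneDimOf ξ h₁) (i : _)).πs.getD ((xiPacketFamilyOfRecordSCD L H hH hHd μω hμu μZ keys (hSCD_of_cmCharIdentityPackageTestSigned L H hH hHd μω hμu Δ mH mG νG νH μZ hQS)) (X.oneDimOf ξ h₁) (i : _)).πn).smoothTrace (μv i) (φf.2 i))))
    -- «A2» OFF COMPACT TYPE both traces VANISH on the test class [Props. 14.4.1 (a), 14.4.2 (c)]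
    (hR₀G : ∀ (P : X.G.Packet) (ξ : X.G.PacketH) (h₁ : X.IsOneDimH ξ), X.G.IsAPacket P → X.G.liftsTo ξ P → ¬ cpt ξ h₁ →
      ∀ φf (f : (CompactlySupportedContinuousMap (cmDatum L 3 (Matrix.of fun i j : Fin 3 => if i.val + j.val + 1 = 3 then (1 : L) else 0)).Adelic ℂ)), (ArchTestKc L ι H T hT φf.1 ∧ (∀ v, IsLocallyConstant (φf.2 v) ∧ HasCompactSupport (φf.2 v)) ∧ {v | φf.2 v ≠ (cmLocalIntegralLevel L 3 H v : Set ((cmDatum L 3 H).Local v)).indicator fun _ => (1 : ℂ)}.Finite) →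
      (Smooth φf ∧ Transfer φf f) → X.G.packetTrace X.tr P f = 0)
    (hR₀H : ∀ (ξ : X.G.PacketH) (h₁ : X.IsOneDimH ξ), ¬ cpt ξ h₁ → ∀ φf (fH : (CompactlySupportedContinuousMap ((cmDatum L 2 (Matrix.of fun i j : Fin 2 => if i.val + j.val + 1 = 2 then (1 : L) else 0)).Adelic × (cmDatum L 1 (Matrix.of fun i j : Fin 1 => if i.val + j.val + 1 = 1 then (1 : L) else 0)).Adelic) ℂ)), (ArchTestKc L ι H T hT φf.1 ∧ (∀ v, IsLocallyConstant (φf.2 v) ∧ HasCompactSupport (φf.2 v)) ∧ {v | φf.2 v ≠ (cmLocalIntegralLevel L 3 H v : Set ((cmDatum L 3 H).Local v)).indicator fun _ => (1 : ℂ)}.Finite) →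
      TransferH φf fH → X.trH ξ fH = 0)
    (Pξ : X.G.Packet) (hA : X.G.IsAPacket Pξ)
    (hevpXi : InnerFormSec146.evp L H μA (xiPacketFamilyOfRecordSCD L H hH hHd μω hμu μZ keys (hSCD_of_cmCharIdentityPackageTestSigned L H hH hHd μω hμu Δ mH mG νG νH μZ hQS)) 𝔩
      (InnerFormSec146.piXiPrime L H μA (xiPacketFamilyOfRecordSCD L H hH hHd μω hμu μZ keys (hSCD_of_cmCharIdentityPackageTestSigned L H hH hHd μω hμu Δ mH mG νG νH μZ hQS)) ξ) (X.finOfG Pξ)) :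
      -- (o4b) THE SLOT READING AT `π′ := classOfSph P hsph`, `P′ := Pξ` (★ p864911's conclusion, `Ξ := Ξ_recordSCD`, letters `(ξ′, h₁)`-indexed as in the head) [p. 244 last display; §12.3 Prop. 12.3.3]
      ∀ (ξ' : X.G.PacketH) (h₁ : X.IsOneDimH ξ') (hS : ∀ v : InnerFormSec146.Place L, v ∈ InnerFormSec146.S0 L H → X.MnNeZero ξ' v),
        X.G.liftsTo ξ' Pξ →
          cpt ξ' h₁ ∧
            ((InnerFormSec146.tupleOf L ι H T hT μA (InnerFormSec146.classOfSph L ι H T hT μA P hsph)).1 = a₀ ξ' h₁ ∨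
              (InnerFormSec146.tupleOf L ι H T hT μA (InnerFormSec146.classOfSph L ι H T hT μA P hsph)).1 = a₂ ξ' h₁) ∧
            ∀ v, (InnerFormSec146.tupleOf L ι H T hT μA (InnerFormSec146.classOfSph L ι H T hT μA P hsph)).2 v =
                ((xiPacketFamilyOfRecordSCD L H hH hHd μω hμu μZ keys (hSCD_of_cmCharIdentityPackageTestSigned L H hH hHd μω hμu Δ mH mG νG νH μZ hQS)) (X.oneDimOf ξ' h₁) v).πn ∨
              (p ξ' h₁ v ∧ (InnerFormSec146.tupleOf L ι H T hT μA (InnerFormSec146.classOfSph L ι H T hT μA P hsph)).2 v =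
                ((xiPacketFamilyOfRecordSCD L H hH hHd μω hμu μZ keys (hSCD_of_cmCharIdentityPackageTestSigned L H hH hHd μω hμu Δ mH mG νG νH μZ hQS)) (X.oneDimOf ξ' h₁) v).πs.getD
                  ((xiPacketFamilyOfRecordSCD L H hH hHd μω hμu μZ keys (hSCD_of_cmCharIdentityPackageTestSigned L H hH hHd μω hμu Δ mH mG νG νH μZ hQS)) (X.oneDimOf ξ' h₁) v).πn) := by
  have hμ : ∀ v, (letI : MeasurableSpace ((cmDatum L 3 H).Local v) := borel _; (μv v).IsHaarMeasure) := hPH.2.2.1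
  have hμK1 : ∀ v, μv v (cmLocalIntegralLevel L 3 H v : Set ((cmDatum L 3 H).Local v)) = 1 := hPH.2.2.2.1
  have hν : (letI : MeasurableSpace (UnitaryGroup.arch (↥(maximalRealSubfield L)) L (IsCMField.complexConj L) 3 H) := borel _; νinf.IsHaarMeasure) := hPH.2.1
  have hleft : ∀ v, (letI : MeasurableSpace ((cmDatum L 3 H).Local v) := borel _; (μv v).IsMulLeftInvariant) :=
    fun v => letI : MeasurableSpace ((cmDatum L 3 H).Local v) := borel _; (hμ v).toIsMulLeftInvariant
  have hχ𝓕 := chiExpansion_gammaSph_of_allClasses_tensOfPair_levels _ _ L ι H T hT μA _ 𝔩 X ν νinf μv hanis (archFinTraceSplit_of_frame L H ι T hT μA ν νinf μv hdef h2) hPH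
    (fun l => InnerFormSec146.IsLevelTest L ι H T hT l) (fun l p hp => ⟨hp.1, hp.2.1, hp.2.2.2⟩) hspecAll htrX
  -- J8-R1∕R2 — (14.6.1) AT `Γ₀` ON THE STABLE ROUTE: Prop. 13.6.1-readings `hG`, `hH61` + vanishing classes + Thm. 14.5.1 (b) (kit shape `h51k`, curried = SEAM 8), ★ `Ch14Bridge.thm1461_of_thm1451b`
  have h61 := Ch14Bridge.thm1461_of_thm1451b
    (InnerFormSec146.gammaSph _ _ _ L ι H T hT μA (xiPacketFamilyOfRecordSCD L H hH hHd μω hμu μZ keys (hSCD_of_cmCharIdentityPackageTestSigned L H hH hHd μω hμu Δ mH mG νG νH μZ hQS)) 𝔩 X)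
    (fun f' f => Smooth f' ∧ Transfer f' f) TransferH hG hH61 hvan hvanH (fun f' f fH hT' hH' => h51k f' f fH hT'.1 ⟨hT'.2, hH'⟩)
  obtain ⟨l₀, hgel⟩ := InnerFormSec146.exists_level_forall_smoothTrace_eq_zero_of_not_isSpherical L H μv hH hHd
    (fun v => letI : MeasurableSpace ((cmDatum L 3 H).Local v) := borel _; ⟨(hμ v).toIsMulLeftInvariant, inferInstance⟩)
  -- ON THE DEEP LEVELS `{l // l₀ ∪ l₁ ⊆ l}` (`l₀` = Gelfand level, ★ p04 (c′); `l₁` = the twist-law floor, F-LEV-1): `hlevTA` ((14.6.2) level sums from `h61` AT ONE GRADED PACKET with finitely many lifts, ★ p863577), `hrigD` (S5 core + Gelfand, ★ p04 (e5′)), `hmn` (★ p863655 `…partnerA`), `hcoeffMem` (★ p863643 `…partnerA'`)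
  have hlevTA := fun l : {l : InnerFormSec146.Level L // l₀ ∪ l₁ ⊆ l} =>
    eq1462LevelTsum_at_of_thm1461_of_separation' (InnerFormSec146.gammaSph _ _ _ L ι H T hT μA (xiPacketFamilyOfRecordSCD L H hH hHd μω hμu μZ keys (hSCD_of_cmCharIdentityPackageTestSigned L H hH hHd μω hμu Δ mH mG νG νH μZ hQS)) 𝔩 X) (fun f' f => Smooth f' ∧ Transfer f' f) TransferH h61
      (InnerFormSec146.IsLevelTest L ι H T hT l.1) (hχ𝓕 l.1) (InnerFormSec146.evOff L H μv l.1) (InnerFormSec146.EvpSupport L H μv l.1) (InnerFormSec146.gradeRep L ι H T hT μA μv l.1) (InnerFormSec146.gradePacket _ _ _ L ι H T hT μA μv _ 𝔩 X l.1) (InnerFormSec146.gradePacketH _ _ _ L ι H T hT μA μv _ 𝔩 X l.1)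
      (fun π' e h => InnerFormSec146.gradeRep_mem_evpSupport L ι H T hT μA μv l.1 π' e h) (fun P e h => InnerFormSec146.gradePacket_mem_evpSupport _ _ L ι H T hT μA μv _ 𝔩 X l.1 P e h) (fun ρ e h => InnerFormSec146.gradePacketH_mem_evpSupport _ _ L ι H T hT μA μv _ 𝔩 X l.1 ρ e h)
      (InnerFormSec146.twistTest L H μv l.1) (tw l.1) (twH l.1) (fun h f' hf' => InnerFormSec146.isLevelTest_twistTest L ι H T hT μv hleft l.1 h f' hf') (hTw l.1 (Finset.union_subset_right l.2)) (hTHw l.1 (Finset.union_subset_right l.2)) (fun h f' hf' π' => InnerFormSec146.trPrime_twistTest_eq_of_factorised L ι H T hT μA μv _ _ _ 𝔩 X hanis hμ hμK1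
        (fun π' φ => archTr₀ L ι H T hT νinf (InnerFormSec146.tupleOf L ι H T hT μA π').1 φ) htrX l.1 (fun v hv c hc => hgel l.1 (Finset.union_subset_left l.2) v hv c hc) h f' hf' π') (hEP l.1 (Finset.union_subset_right l.2)) (hEH l.1 (Finset.union_subset_right l.2)) (hsepL l.1) (htP l.1) (hliftE l.1)
  have hrigD := fun l : {l : InnerFormSec146.Level L // l₀ ∪ l₁ ⊆ l} => InnerFormSec146.gradeRep_eq_of_evpRigidityCore _ _ L ι H T hT μA μv _ 𝔩 X hanis hμ hμK1
    (fun π' φ => archTr₀ L ι H T hT νinf (InnerFormSec146.tupleOf L ι H T hT μA π').1 φ) htrX l.1 (fun v hv c hc => hgel l.1 (Finset.union_subset_left l.2) v hv c hc) (hcore l.1)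
  -- ★ (o4a) THE ROW-34-SHAPED SLOT READING (R90-IF-p01 (g2), M2b-slot twin) — ★ M3's `hcoeffMem` argument list TOKEN FOR TOKEN: the partner-guarded cover `hcoverP` from `hcover𝓣`,
  -- the `tsum` level identity AT THE A-PACKET `(P, ξ)` from `hlevTA` with `|Π̂(P)| < ∞` from `lifts P = {ξ}`, the germ read-back ★ `evpRep_gammaSph_of_grade_eq`, `hrig := hrigD`
  have hslot := archSlot_binder_gammaSph_recordSCD_atUnitsOfRecord_partnerA2' L ι H T hT νinf μv hdef hν hμ hH hHd μω hμu μZ keys _ μA 𝔩 hμω hquad hμK1 hanis hF1b hARCH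
    X (fun f' f => Smooth f' ∧ Transfer f' f) TransferH htrX p hp a₀ a₂ ha₀ ha₂ hane cpt hR₁ hR₂ hR₀G hR₀H
    (fun l : {l : InnerFormSec146.Level L // l₀ ∪ l₁ ⊆ l} => InnerFormSec146.IsLevelTest L ι H T hT l.1)
    (fun l f' h => (hχ𝓕 l.1 f' h).1)
    (fun l => InnerFormSec146.gradeRep L ι H T hT μA μv l.1) (fun l => InnerFormSec146.gradePacket _ _ _ L ι H T hT μA μv _ 𝔩 X l.1)
      -- (CMP-cov) VERDICT (ⅱ): the partner-guarded cover `hcoverP` from `hcover𝓣` (★ p863134 pays it at `X_cm`)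
      (fun f' _ P hφ hpart _ => by
        obtain ⟨l, hl, e, hF, hP⟩ := hcover𝓣 f' hφ P hpart (l₀ ∪ l₁)
        exact ⟨⟨l, hl⟩, e, hF, hP⟩)
    -- (LF-cut) the `tsum` level identity AT THE A-PACKET `(P, ξ)`, `|Π̂(P)| < ∞` from `lifts P = {ξ}`
    (fun l f' f fH hF hf hfH P ξ hA h₁ hl e hP => hlevTA l f' f fH hF hf hfH P e hP ((Set.finite_singleton ξ).subset (hlifts1 P ξ hA h₁ hl).subset))
    (fun l π' P e hP hπ => InnerFormSec146.evpRep_gammaSph_of_grade_eq _ _ L ι H T hT μA μv _ 𝔩 X hμ l.1 π' P e hP hπ)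
    (fun l f' hF π' P e hP hevp hne => hrigD l f' hF π' P e hP hevp hne)
    hlifts1 hn hnH hex
  -- THE TRIGGER AT `π′ := [P]`, `P′ := Pξ` (★ M3 :385's bytes): «t([P]) = t(Π(ξ))» from the (AE) string + `hevpXi` read back by `rfl` (★ `gammaSph_evpRep_classOfSph`, ★ `evpRep_classOf`),
  -- and «m′([P]) ≠ 0» for the anisotropic `H` (★ `mPrimeSph_ne_zero`)
  intro ξ' h₁ hS hl
  exact hslot (InnerFormSec146.dSplit L H) Pξ ξ' h₁ hS hA hl (InnerFormSec146.classOfSph L ι H T hT μA P hsph)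
    ((InnerFormSec146.gammaSph_evpRep_classOfSph _ _ _ L ι H T hT μA _ 𝔩 X P hsph Pξ).2 ((InnerFormSec146.evpRep_classOf L H μA 𝔩 P (X.finOfG Pξ)).1
      (evpRep_of_ae_of_evp_piXiPrime L H hH hHd Δ mH mG νG νH μω hμu hQS μZ keys ξ μA P hanis hAE 𝔩 (X.finOfG Pξ) hevpXi)))
    (InnerFormSec146.mPrimeSph_ne_zero L ι H T hT μA hanis _)

end Summit.HodgeConjecture.HodgeConjecture.R90.S9

end
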